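import Summits.BirchSwinnertonDyer.Rank1Residual.Supersingular.X7TwistClauseOPEN
import Literature.NumberTheory.EllipticCurves.BurungaleSkinnerTianWan2024.QuadraticTwistPPartOPEN
import HarnessLib

/-!
# Route `SignedLowerHalves`, crux `KobayashiLowerHalfLargeImage` (item stmt-BirchSwinnertonDyer-19001): the
# BSTW-TWIST SUB-FAMILY of class X7 — CLASS-WIDE CONSUMERS OF A TWIST DATUM (cell `pub/bsd-litref`, paper sub-dir
# `bstw24`, prover seat `bsd-litref-bstw24-pv` gen 6; companion of `…BSTWTwistRecordShape.lean`; a `--supports … --as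
# helper` file; THEOREMS ONLY; closes nothing)

HONEST FRAMING (programme BSD-LIT2PART v1 §HONESTY, verbatim): «no tranche here proves BSD; ARM L moves the LITERAL
column of an r ≤ 1 census into the kernel-proved-modulo-named-print column; ARM P changes what "named print" is
worth.» Burungale–Skinner–Tian–Wan arXiv:2409.01350v2 is an UNREFEREED PREPRINT: its twist clause enters ONLY through
the tree's explicitly labelled OPEN binders `Literature.….BurungaleSkinnerTianWan2024.thm15_twist_pPart_OPEN` (Thm. 1.5
with Thm. 1.3, INTRO wording «disc K coprime to Np and divisible only by primes of ordinary reduction for E») and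
`….cor102_twist_pPart_OPEN` (Cor. 10.2, BODY wording «disc K coprime to Np», the WIDER clause; proved edge body ⟹ intro
= `thm15_twist_of_cor102_twist_OPEN`), taken as HYPOTHESES — never as theorems. Closes nothing; class X7 stays
CONSTRUCTION-SHAPED; crux 3 stays OPEN; the desk (referee A) words any tier; typed ≠ proved ≠ endorsed.

WHAT. The per-pair records `…BSTWTwistRecordsNN.lean` prove for each census pair `(E, p)` of the BSTW-twist sub-family
ONE binder-free, unconditional theorem `twist_x7bstw_<label>_<p>` — the TWIST DATUM: `∃ W₀ d C`, `W₀` semistable, `p`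
good supersingular for `W₀` with `a_p(W₀) = 0`, `d` square-free `≠ 1`, every prime ramified in `ℚ(√d)` `≠ p` and good
ordinary (INTRO datum) resp. good (BODY datum) for `W₀`, `C • W = W₀^{(d)}` (shapes `X7Twist.exists_twistIntro_of_certs` /
`exists_twistBody_of_certs`). THIS file is where a binder meets a datum, CLASS-WIDE, once:

* `twistBody_of_twistIntro` — an INTRO datum is a BODY datum (good ordinary ⟹ good);
* `goodSS_of_twistBody` — the twist of a datum is good supersingular at `p` (`p ∤ 2d`, `goodSS_of_smul_eq_quadraticTwist`);
* `bsdp_of_thm15_twist_OPEN_of_twistIntro` — `BSDp W p` from an INTRO datum, modulo `thm15_twist_pPart_OPEN` + GZK + the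
  analytic rank `≤ 1` (DATA), via `Supersingular.bsdp_of_thm15_twist_OPEN'` (`Irr W p` automatic, Serre 1972 Prop. 12);
* `bsdp_of_cor102_twist_OPEN_of_twistBody` — the same from a BODY datum modulo `cor102_twist_pPart_OPEN`, `Irr W p` from
  the twist's own supersingularity (`hasIrreducibleModPGaloisRep_of_dvd_frobeniusTrace`), ramified primes good ⟹ prime
  to `N₀` (`dvd_conductorNorm_iff_not_hasGoodReductionAtPrime`);
* `bsdp_of_cor102_twist_OPEN_of_twistIntro` — bookkeeping through the proved edge body ⟹ intro.

When the litref D-audit of the twist clause (sheets `pub/bsd-litref/bstw24/sheets/D-AUDIT-bstw24-r{1,2}-TWIST.md`,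
referee C4) attaches a scope and `bsd-litref-bstw24-ty` files the S-scoped twist tiers (one extra hypothesis ON THE
TWIST, `BSTWScope.HasAuxWitness W p`, certified per pair by `X7Twist.hasAuxWitness_of_certs`), the matching consumer is
ONE more theorem here and the per-pair re-display a one-line composition — no per-pair kernel work is redone.
Design: THEOREMS ONLY; default heartbeats; axioms standard.

References: [BurungaleSkinnerTianWan2024] arXiv:2409.01350v2 Thm. 1.3 / 1.5 twist clause (pp. 3–4), Cor. 10.2 (p. 86);
[Serre1972] §1.11 Prop. 12; [Knapp1993] Prop. 12.10; [SilvermanAEC2009] VII.5 Prop. 5.1, X.5 Cor. 5.4; [Miller2011LMS]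
§1, Def. 1.1.
-/

set_option autoImplicit false
set_option linter.dupNamespace false

noncomputable section

open scoped Classical

open WeierstrassCurve Literature.NumberTheory.EllipticCurves
  Literature.NumberTheory.EllipticCurves.Rank1Residual
  Literature.NumberTheory.EllipticCurves.BurungaleSkinnerTianWan2024
  Summit.BirchSwinnertonDyer.Rank1Residual.Supersingular

namespace Summit.BirchSwinnertonDyer.BirchSwinnertonDyer.Theorems.X7Twist

section Consumers

variable (W : WeierstrassCurve ℚ) [W.IsElliptic] [W.IsGloballyMinimal] (p : ℕ) [Fact p.Prime]

omit [W.IsElliptic] [W.IsGloballyMinimal] in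
/-- **The INTRO datum implies the BODY datum** (good ordinary ⟹ good). Bookkeeping.
[cite: BurungaleSkinnerTianWan2024, Thm. 1.3 versus Cor. 10.2 (twist clauses; shape only)] -/
theorem twistBody_of_twistIntro
    (htw : ∃ (W₀ : WeierstrassCurve ℚ) (_ : W₀.IsElliptic) (_ : W₀.IsGloballyMinimal) (d : ℤ) (C : VariableChange ℚ),
      Semistable W₀ ∧ GoodSS W₀ p ∧ W₀.frobeniusTrace p = 0 ∧ Squarefree d ∧ d ≠ 1 ∧
      (∀ (q : ℕ) [Fact q.Prime], RamifiedInQuadratic d q → q ≠ p ∧ GoodOrd W₀ q) ∧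
      C • W = W₀.quadraticTwist (d : ℚ)) :
    ∃ (W₀ : WeierstrassCurve ℚ) (_ : W₀.IsElliptic) (_ : W₀.IsGloballyMinimal) (d : ℤ) (C : VariableChange ℚ),
      Semistable W₀ ∧ GoodSS W₀ p ∧ W₀.frobeniusTrace p = 0 ∧ Squarefree d ∧ d ≠ 1 ∧
      (∀ (q : ℕ) [Fact q.Prime], RamifiedInQuadratic d q → q ≠ p ∧ W₀.HasGoodReductionAtPrime q) ∧
      C • W = W₀.quadraticTwist (d : ℚ) := by
  obtain ⟨W₀, _, _, d, C, hsst, hss, hap, hd, hd1, hram, hC⟩ := htw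
  exact ⟨W₀, ‹_›, ‹_›, d, C, hsst, hss, hap, hd, hd1, fun q _ h ↦ ⟨(hram q h).1, (hram q h).2.1⟩, hC⟩

omit [W.IsElliptic] in
/-- **The twist of a BODY datum is good supersingular at `p`** (`p ∤ 2d` since `p` is odd and would otherwise be ramified,
hence `≠ p`; then `goodSS_of_smul_eq_quadraticTwist`). [cite: Knapp1993, Prop. 12.10] [cite: SilvermanAEC2009, VII.5 Prop. 5.1(a)] -/
theorem goodSS_of_twistBody (hp2 : p ≠ 2)
    (htw : ∃ (W₀ : WeierstrassCurve ℚ) (_ : W₀.IsElliptic) (_ : W₀.IsGloballyMinimal) (d : ℤ) (C : VariableChange ℚ),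
      Semistable W₀ ∧ GoodSS W₀ p ∧ W₀.frobeniusTrace p = 0 ∧ Squarefree d ∧ d ≠ 1 ∧
      (∀ (q : ℕ) [Fact q.Prime], RamifiedInQuadratic d q → q ≠ p ∧ W₀.HasGoodReductionAtPrime q) ∧
      C • W = W₀.quadraticTwist (d : ℚ)) : GoodSS W p := by
  obtain ⟨W₀, _, _, d, C, -, hss, -, hd, -, hram, hC⟩ := htw
  have hp2d : ¬ (p : ℤ) ∣ 2 * d := by
    intro h
    have hpP : p.Prime := Fact.out
    have hpZ : Prime (p : ℤ) := Nat.prime_iff_prime_int.mp hpP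
    rcases hpZ.dvd_or_dvd h with h2 | hdvd
    · have : p ∣ 2 := by exact_mod_cast h2
      exact hp2 ((Nat.prime_dvd_prime_iff_eq hpP Nat.prime_two).mp this)
    · exact (hram p (Or.inl hdvd)).1 rfl
  exact goodSS_of_smul_eq_quadraticTwist W₀ W p hss hd hC hp2d

/-- **`BSD(E, p)` from an INTRO twist datum, CONDITIONAL on BSTW's twist clause (INTRO wording).** Binders: the PRE hypothesis
`thm15_twist_pPart_OPEN` (UNREFEREED preprint; never a theorem), GZK `hGZK` (PUBLISHED, by name), the pair's analytic rank
`rk ≤ 1` (DATA). Class road `Supersingular.bsdp_of_thm15_twist_OPEN'` (`Irr W p` automatic, Serre 1972 Prop. 12). Closes nothing;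
X7 stays CONSTRUCTION-SHAPED. [claim: BurungaleSkinnerTianWan2024, status: under-review]
[cite: BurungaleSkinnerTianWan2024, Thm. 1.5 with Thm. 1.3 (twist clause, pp. 3–4; ANNOUNCED, OPEN binder)]
[cite: Serre1972, §1.11 Prop. 12] [cite: Miller2011LMS, §1 and Def. 1.1] -/
theorem bsdp_of_thm15_twist_OPEN_of_twistIntro (hBSTW : thm15_twist_pPart_OPEN)
    (hGZK : rank_eq_analyticRank_of_analyticRank_le_one) (hp2 : p ≠ 2)
    (htw : ∃ (W₀ : WeierstrassCurve ℚ) (_ : W₀.IsElliptic) (_ : W₀.IsGloballyMinimal) (d : ℤ) (C : VariableChange ℚ),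
      Semistable W₀ ∧ GoodSS W₀ p ∧ W₀.frobeniusTrace p = 0 ∧ Squarefree d ∧ d ≠ 1 ∧
      (∀ (q : ℕ) [Fact q.Prime], RamifiedInQuadratic d q → q ≠ p ∧ GoodOrd W₀ q) ∧
      C • W = W₀.quadraticTwist (d : ℚ))
    {rk : ℕ} (hr : W.analyticRank = rk) (hrk : rk ≤ 1) : BSDp W p := by
  obtain ⟨W₀, _, _, d, C, hsst, hss, hap, hd, hd1, hram, hC⟩ := htw
  have h4 : p = 3 → W₀.frobeniusTrace 3 = 0 := by intro h3; subst h3; exact hap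
  exact bsdp_of_thm15_twist_OPEN' W₀ W p hBSTW hGZK hp2 hsst hss h4 hd hd1 hram hC (by omega)

/-- **`BSD(E, p)` from a BODY twist datum, CONDITIONAL on BSTW's twist clause (BODY wording, Cor. 10.2).** Binders: the PRE
hypothesis `cor102_twist_pPart_OPEN` (UNREFEREED preprint, the WIDER clause; never a theorem), GZK `hGZK`, the pair's analytic
rank `rk ≤ 1` (DATA); `Irr W p` from the twist's own good supersingular reduction at the odd `p` (`goodSS_of_twistBody`,
`hasIrreducibleModPGaloisRep_of_dvd_frobeniusTrace`); ramified primes good ⟹ prime to `N₀`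
(`dvd_conductorNorm_iff_not_hasGoodReductionAtPrime`). Closes nothing. [claim: BurungaleSkinnerTianWan2024, status: under-review]
[cite: BurungaleSkinnerTianWan2024, Cor. 10.2, last sentence (p. 86; ANNOUNCED, OPEN binder)] [cite: Serre1972, §1.11 Prop. 12]
[cite: Miller2011LMS, §1 and Def. 1.1] -/
theorem bsdp_of_cor102_twist_OPEN_of_twistBody (hBSTW : cor102_twist_pPart_OPEN)
    (hGZK : rank_eq_analyticRank_of_analyticRank_le_one) (hp2 : p ≠ 2)
    (htw : ∃ (W₀ : WeierstrassCurve ℚ) (_ : W₀.IsElliptic) (_ : W₀.IsGloballyMinimal) (d : ℤ) (C : VariableChange ℚ),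
      Semistable W₀ ∧ GoodSS W₀ p ∧ W₀.frobeniusTrace p = 0 ∧ Squarefree d ∧ d ≠ 1 ∧
      (∀ (q : ℕ) [Fact q.Prime], RamifiedInQuadratic d q → q ≠ p ∧ W₀.HasGoodReductionAtPrime q) ∧
      C • W = W₀.quadraticTwist (d : ℚ))
    {rk : ℕ} (hr : W.analyticRank = rk) (hrk : rk ≤ 1) : BSDp W p := by
  have hG := goodSS_of_twistBody W p hp2 htw
  obtain ⟨W₀, _, _, d, C, hsst, hss, hap, hd, hd1, hram, hC⟩ := htw
  have hram' : ∀ (q : ℕ) [Fact q.Prime], RamifiedInQuadratic d q → q ≠ p ∧ ¬ q ∣ W₀.conductorNorm ℤ := by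
    intro q _ h
    obtain ⟨hqp, hgood⟩ := hram q h
    exact ⟨hqp, fun hdvd ↦ (W₀.dvd_conductorNorm_iff_not_hasGoodReductionAtPrime q).mp hdvd hgood⟩
  have hirr : Irr W p :=
    hasIrreducibleModPGaloisRep_of_dvd_frobeniusTrace W p hp2
      (W.not_dvd_minimalDiscriminantInt_of_hasGoodReductionAtPrime' p hG.1) hG.2
  exact bsdp_of_cor102_twist_OPEN hBSTW hGZK W₀ W p hp2 hsst hss.1 hap hd hd1 hram' hC hirr (by omega)

/-- **`BSD(E, p)` from an INTRO twist datum under the BODY binder** (the body clause implies the intro clause,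
`thm15_twist_of_cor102_twist_OPEN`; bookkeeping so that a holder of `cor102_twist_pPart_OPEN` reaches every record).
Closes nothing. [claim: BurungaleSkinnerTianWan2024, status: under-review]
[cite: BurungaleSkinnerTianWan2024, Cor. 10.2 (p. 86) versus Thm. 1.5 with Thm. 1.3 (pp. 3–4) (twist clauses; OPEN binders)] -/
theorem bsdp_of_cor102_twist_OPEN_of_twistIntro (hBSTW : cor102_twist_pPart_OPEN)
    (hGZK : rank_eq_analyticRank_of_analyticRank_le_one) (hp2 : p ≠ 2)
    (htw : ∃ (W₀ : WeierstrassCurve ℚ) (_ : W₀.IsElliptic) (_ : W₀.IsGloballyMinimal) (d : ℤ) (C : VariableChange ℚ),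
      Semistable W₀ ∧ GoodSS W₀ p ∧ W₀.frobeniusTrace p = 0 ∧ Squarefree d ∧ d ≠ 1 ∧
      (∀ (q : ℕ) [Fact q.Prime], RamifiedInQuadratic d q → q ≠ p ∧ GoodOrd W₀ q) ∧
      C • W = W₀.quadraticTwist (d : ℚ))
    {rk : ℕ} (hr : W.analyticRank = rk) (hrk : rk ≤ 1) : BSDp W p :=
  bsdp_of_thm15_twist_OPEN_of_twistIntro W p (thm15_twist_of_cor102_twist_OPEN hBSTW) hGZK hp2 htw hr hrk

end Consumers

end Summit.BirchSwinnertonDyer.BirchSwinnertonDyer.Theorems.X7Twist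

end
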